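import Mathlib
import HarnessLib
import Literature.Analysis.FluidPDE.ScarNonuniquenessWitnesses
import Summits.NavierStokesRegularity.NavierStokesRegularity.Theorems.LrcModEntire.Negative.FalseWithoutMild
import Summits.NavierStokesRegularity.NavierStokesRegularity.Theorems.PoloidalWindowRigidity.Negative.NonflatStubFalseWithoutMild

/-!
# Crux K2 `PoloidalWindowRigidity` (stmt-NavierStokesRegularity-19708), skeleton lrc-jet v4 — negative side:
# the delegable stub (TH) `stub_timeHeightShear` is FALSE without the Oseen-mild identity

Negative-side support (refuter seat ns-regularity-refuter1, cell ns-regularity-ideate; D-0081 §C). The registered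
stub `stub_timeHeightShear` of skeleton `Cruxes/PoloidalWindowRigidity/Lines/lrc_jet.lean` (v4, K2 lead
ns-poloidal-K2-p1 g5) says: a profile of the route's Type-I ancient mild class — (R) Type-I time rate, (C) continuity
on the open backward slab, (M) the unit-viscosity Oseen-mild identity, (D) divergence-free slices — which is
(P) poloidal along `e₂`, and which on some non-empty open space–time set `W` of the slab carries the three
non-degeneracy pins, has a shear slope that is NOT a function of time alone on any open subset of `W`, but IS a
function of time and height on `W` (`∂₂ v_b = m(t, x₂) ∂_b v₂`, `b = 0, 1`), is not backward-singular at the apex.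

The shifted cellular Type-I profile of `…LrcModEntire.Negative.ShiftField`,
`v(t, x) = (−t)^{-1/2} (cos x₂ cos x₀, cos x₂ cos x₁, (sin x₂ + 3)(sin x₀ + sin x₁))`, lies EXACTLY in this stratum:
its slope `μ(x₂) = −sin x₂ / (sin x₂ + 3)` is a function of height alone and of time alone on no open set
(`…LrcModEntire.Negative.FalseWithoutMild`). This file adds:

* `norm_cellField_le_norm_shiftField`, `isBackwardSingularPoint_shiftProfile`: the profile dominates the cellular
  profile of `…Negative.CellField` pointwise in norm, hence is backward-singular at the apex (monotonicity
  `Literature.Analysis.FluidPDE.isBackwardSingularPoint_of_norm_le` from `isBackwardSingularPoint_cellProfile`);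
* `shiftProfile_timeHeightSlope`: the (TH) slope identity `∂₂ v_b = μ(x₂) ∂_b v₂`, `b ≠ 2`, at every point;
* `timeHeightShear_false_without_mild`: the text of `stub_timeHeightShear` VERBATIM with hypothesis (M) deleted is
  FALSE (`C = 10`, window `{t < 0} × {cos x₀ > 0, 0 < x₂ < π/2}`);
* `lrcSpatialOfSingular_false_without_mild`: likewise for the skeleton's assembled target `lrcSpatial_of_stubs`
  (LRC″ with spatial pins under the singularity assumption) with (M) deleted.

So (M) is load-bearing for the delegable stub too: inside the thin stratum (TH) the Type-I rate, continuity,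
incompressibility, poloidality (here even the frozen constraint) and a height-dependent slope with `μ′ ≢ 0` do not
prevent a backward singularity — any proof of `stub_timeHeightShear` must use the Navier–Stokes dynamics through (M),
e.g. the (TH) pressure law `…PoloidalWindowRigidityTimeHeightShearPressure` (p530500).

WHAT THIS IS NOT: not a claim about Navier–Stokes regularity and not a refutation of the stub — a kernel-checked
certificate that its hypothesis (M) cannot be dropped (information for the K2 lead's line census).
-/

noncomputable section

-- the summit and its single sub-problem share the name (CONVENTIONS §1), as in every Theorems file
set_option linter.dupNamespace false

namespace Summit.NavierStokesRegularity.NavierStokesRegularity.Theorems.PoloidalWindowRigidity.Negative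

open MeasureTheory Set Function Filter Topology Metric
open scoped RealInnerProductSpace InnerProductSpace
open Literature.Analysis Literature.Analysis.FluidPDE
open Summit.NavierStokesRegularity.NavierStokesRegularity.Theorems.LrcModEntire.Negative

/-! ## The shifted cellular profile is backward-singular -/

/-- The cellular field is dominated componentwise, hence in norm, by the shifted cellular field
(`|sin x₂| ≤ sin x₂ + 3` on the vertical component, equal horizontal components). [folklore] -/
theorem norm_cellField_le_norm_shiftField (x : EuclideanSpace ℝ (Fin 3)) : ‖cellField x‖ ≤ ‖shiftField x‖ := by
  rw [EuclideanSpace.norm_eq, EuclideanSpace.norm_eq]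
  apply Real.sqrt_le_sqrt
  simp only [Fin.sum_univ_three, Real.norm_eq_abs, sq_abs, cellField_apply_zero, cellField_apply_one,
    cellField_apply_two, shiftField_apply_zero, shiftField_apply_one, shiftField_apply_two]
  have hs := Real.neg_one_le_sin (x 2)
  have hP : 0 ≤ (Real.sin (x 0) + Real.sin (x 1)) ^ 2 * (6 * Real.sin (x 2) + 9) :=
    mul_nonneg (sq_nonneg _) (by linarith)
  nlinarith [hP]

/-- `‖cellProfile t x‖ ≤ ‖shiftProfile t x‖`. [folklore] -/
theorem norm_cellProfile_le_norm_shiftProfile (t : ℝ) (x : EuclideanSpace ℝ (Fin 3)) :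
    ‖cellProfile t x‖ ≤ ‖shiftProfile t x‖ := by
  simp only [cellProfile, shiftProfile, norm_smul]
  exact mul_le_mul_of_nonneg_left (norm_cellField_le_norm_shiftField x) (norm_nonneg _)

/-- **(S) the shifted cellular profile is backward-singular at the apex** (monotonicity of backward singularity,
from `isBackwardSingularPoint_cellProfile`). [folklore] -/
theorem isBackwardSingularPoint_shiftProfile : IsBackwardSingularPoint shiftProfile 0 :=
  isBackwardSingularPoint_of_norm_le isBackwardSingularPoint_cellProfile norm_cellProfile_le_norm_shiftProfile

/-! ## The slope is a function of height -/

/-- **The shear slope is a function of height alone**: `∂₂ v_b = μ(x₂) ∂_b v₂` for `b = 0, 1` with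
`μ(h) = −sin h / (sin h + 3)`, at every space–time point `z = (t, x)`. [folklore] -/
theorem shiftProfile_timeHeightSlope (z : ℝ × EuclideanSpace ℝ (Fin 3)) (b : Fin 3) (hb : b ≠ 2) :
    fderiv ℝ (shiftProfile z.1) z.2 (EuclideanSpace.single 2 1) b =
      (fun (_ h : ℝ) => -Real.sin h / (Real.sin h + 3)) z.1 (z.2 2) *
        fderiv ℝ (shiftProfile z.1) z.2 (EuclideanSpace.single b 1) 2 := by
  have h3 : Real.sin (z.2 2) + 3 ≠ 0 := by
    have := Real.neg_one_le_sin (z.2 2); intro h; linarith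
  have key0 : fderiv ℝ (shiftProfile z.1) z.2 (EuclideanSpace.single 2 1) 0 =
      (fun (_ h : ℝ) => -Real.sin h / (Real.sin h + 3)) z.1 (z.2 2) *
        fderiv ℝ (shiftProfile z.1) z.2 (EuclideanSpace.single 0 1) 2 := by
    rw [fderiv_shiftProfile_e2_apply_zero, fderiv_shiftProfile_e0_apply_two]
    field_simp
  have key1 : fderiv ℝ (shiftProfile z.1) z.2 (EuclideanSpace.single 2 1) 1 =
      (fun (_ h : ℝ) => -Real.sin h / (Real.sin h + 3)) z.1 (z.2 2) *
        fderiv ℝ (shiftProfile z.1) z.2 (EuclideanSpace.single 1 1) 2 := by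
    rw [fderiv_shiftProfile_e2_apply_one, fderiv_shiftProfile_e1_apply_two]
    field_simp
  fin_cases b
  · exact key0
  · exact key1
  · exact absurd rfl hb

/-! ## The stub minus the Oseen-mild identity is false -/

/-- **`stub_timeHeightShear` (skeleton lrc-jet v4 of crux 19708) without the Oseen-mild identity is FALSE.** The
negated statement is the registered stub VERBATIM with its third hypothesis (the unit-viscosity Oseen-mild identity
`v t x = heatExtension (v s) (t − s) x − oseenDuhamel 1 s v v t x` for `s < t < 0`) deleted. Witness: the shifted
cellular Type-I profile (`C = 10`) on the window `{t < 0} × {cos x₀ > 0, 0 < x₂ < π/2}`: it has (R), (C), (D), is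
poloidal along `e₂`, carries the three pins there, its slope `−sin x₂/(sin x₂ + 3)` is time-only on no open subset
but is a function of `(t, x₂)` — and the profile IS backward-singular at the apex. Hence (M) is load-bearing for the
(TH) stub: the thin stratum is not emptied of singular profiles by kinematics and the Type-I rate alone. [folklore] -/
theorem timeHeightShear_false_without_mild :
    ¬ (∀ (C : ℝ) (v : ℝ → EuclideanSpace ℝ (Fin 3) → EuclideanSpace ℝ (Fin 3)),
        HasTypeITimeDecay C v →
        ContinuousOn (Function.uncurry v) (Set.Iio (0 : ℝ) ×ˢ Set.univ) →
        (∀ t < 0, VectorCalculus.IsDivFree (v t)) →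
        (∀ s < 0, ∀ y, ⟪curl (v s) y, EuclideanSpace.single 2 1⟫_ℝ = 0) →
        ∀ W : Set (ℝ × EuclideanSpace ℝ (Fin 3)), IsOpen W → W.Nonempty → W ⊆ Set.Iio (0 : ℝ) ×ˢ Set.univ →
        (∀ z ∈ W, curl (v z.1) z.2 ≠ 0 ∧
          (fderiv ℝ (v z.1) z.2 (EuclideanSpace.single 0 1) 2 ≠ 0 ∨
            fderiv ℝ (v z.1) z.2 (EuclideanSpace.single 1 1) 2 ≠ 0) ∧
          (fderiv ℝ (v z.1) z.2 (EuclideanSpace.single 2 1) 0 ≠ 0 ∨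
            fderiv ℝ (v z.1) z.2 (EuclideanSpace.single 2 1) 1 ≠ 0)) →
        (∀ m : ℝ → ℝ, ∀ W₁ : Set (ℝ × EuclideanSpace ℝ (Fin 3)), W₁ ⊆ W → IsOpen W₁ → W₁.Nonempty →
          ∃ z ∈ W₁, ∃ b : Fin 3, b ≠ 2 ∧
            fderiv ℝ (v z.1) z.2 (EuclideanSpace.single 2 1) b ≠
              m z.1 * fderiv ℝ (v z.1) z.2 (EuclideanSpace.single b 1) 2) →
        (∃ m : ℝ → ℝ → ℝ, ∀ z ∈ W, ∀ b : Fin 3, b ≠ 2 →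
          fderiv ℝ (v z.1) z.2 (EuclideanSpace.single 2 1) b =
            m z.1 (z.2 2) * fderiv ℝ (v z.1) z.2 (EuclideanSpace.single b 1) 2) →
        ¬ IsBackwardSingularPoint v 0) := by
  intro H
  exact H 10 shiftProfile hasTypeITimeDecay_shiftProfile continuousOn_shiftProfile
    (fun t _ => isDivFree_shiftProfile t) (fun s _ y => poloidal_shiftProfile s y) shiftWindow isOpen_shiftWindow
    shiftWindow_nonempty shiftWindow_subset shiftProfile_pins
    (fun m W₁ hW₁ hW₁o hW₁n => shiftProfile_slope_not_time_only m W₁ hW₁ hW₁o hW₁n)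
    ⟨fun _ h => -Real.sin h / (Real.sin h + 3), fun z _ b hb => shiftProfile_timeHeightSlope z b hb⟩
    isBackwardSingularPoint_shiftProfile

/-- **The skeleton's assembled target `lrcSpatial_of_stubs` (LRC″ with spatial pins UNDER the singularity
assumption) without the Oseen-mild identity is FALSE**, by the same witness: it is backward-singular at the apex,
carries the pins and the time-pin on the window, and no slice has a vorticity translation germ or a vertical-axis
rotation germ on any window (`…LrcModEntire.Negative.shiftProfile_no_translation_germ/_no_rotation_germ`). So
the contradiction the skeleton derives from its two stubs is itself (M)-load-bearing. [folklore] -/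
theorem lrcSpatialOfSingular_false_without_mild :
    ¬ (∀ (C : ℝ) (v : ℝ → EuclideanSpace ℝ (Fin 3) → EuclideanSpace ℝ (Fin 3)),
        HasTypeITimeDecay C v →
        ContinuousOn (Function.uncurry v) (Set.Iio (0 : ℝ) ×ˢ Set.univ) →
        (∀ t < 0, VectorCalculus.IsDivFree (v t)) →
        (∀ s < 0, ∀ y, ⟪curl (v s) y, EuclideanSpace.single 2 1⟫_ℝ = 0) →
        IsBackwardSingularPoint v 0 →
        ∀ W : Set (ℝ × EuclideanSpace ℝ (Fin 3)), IsOpen W → W.Nonempty → W ⊆ Set.Iio (0 : ℝ) ×ˢ Set.univ →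
        (∀ z ∈ W, curl (v z.1) z.2 ≠ 0 ∧
          (fderiv ℝ (v z.1) z.2 (EuclideanSpace.single 0 1) 2 ≠ 0 ∨
            fderiv ℝ (v z.1) z.2 (EuclideanSpace.single 1 1) 2 ≠ 0) ∧
          (fderiv ℝ (v z.1) z.2 (EuclideanSpace.single 2 1) 0 ≠ 0 ∨
            fderiv ℝ (v z.1) z.2 (EuclideanSpace.single 2 1) 1 ≠ 0)) →
        (∀ m : ℝ → ℝ, ∀ W₁ : Set (ℝ × EuclideanSpace ℝ (Fin 3)), W₁ ⊆ W → IsOpen W₁ → W₁.Nonempty →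
          ∃ z ∈ W₁, ∃ b : Fin 3, b ≠ 2 ∧
            fderiv ℝ (v z.1) z.2 (EuclideanSpace.single 2 1) b ≠
              m z.1 * fderiv ℝ (v z.1) z.2 (EuclideanSpace.single b 1) 2) →
        ∃ s : ℝ, s < 0 ∧ ∃ U : Set (EuclideanSpace ℝ (Fin 3)), IsOpen U ∧ U.Nonempty ∧
          ((∃ e : EuclideanSpace ℝ (Fin 3), e ≠ 0 ∧ ∀ y ∈ U, fderiv ℝ (curl (v s)) y e = 0) ∨
           (∃ c : EuclideanSpace ℝ (Fin 3), ∀ y ∈ U,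
              rotGen (curl (v s) y) = fderiv ℝ (curl (v s)) y (rotGen (y - c))))) := by
  intro H
  obtain ⟨s, hs, U, hU, hne, halt⟩ := H 10 shiftProfile hasTypeITimeDecay_shiftProfile continuousOn_shiftProfile
    (fun t _ => isDivFree_shiftProfile t) (fun s _ y => poloidal_shiftProfile s y)
    isBackwardSingularPoint_shiftProfile shiftWindow isOpen_shiftWindow
    shiftWindow_nonempty shiftWindow_subset shiftProfile_pins
    (fun m W₁ hW₁ hW₁o hW₁n => shiftProfile_slope_not_time_only m W₁ hW₁ hW₁o hW₁n)
  rcases halt with ⟨e, he, htr⟩ | ⟨c, hrot⟩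
  · exact shiftProfile_no_translation_germ hs hU hne he htr
  · exact shiftProfile_no_rotation_germ hs hU hne c hrot

end Summit.NavierStokesRegularity.NavierStokesRegularity.Theorems.PoloidalWindowRigidity.Negative

end
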